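import Mathlib
import Literature.AlgebraicGeometry.Resolution.CobordantGame
import Literature.AlgebraicGeometry.Resolution.CobordantChartCoefficients
import Literature.AlgebraicGeometry.Resolution.FormalCoordinateChange
import Summits.ResolutionOfSingularities.ResolutionOfSingularities.Theorems.WeightedInvariantLocalWeightedDropArrangementDoublePointPerturbed

/-!
# `WeightedInvariant.LocalWeightedDrop`: the TRANSLATE-CROSS CRITERION for double points over hyperplane arrangements (characteristic 2)

Crux item stmt-ResolutionOfSingularities-8899 `LocalWeightedDrop`, skeleton v31, residual stubs W4|₄ / W4|₅₊ (`d = 2`).  [OURS · L1 W4.3, chain w43,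
stub worker 4 (gen 4): the METHOD of the specimen `ArrangementDoublePoint.arrangementDoublePoint_won`, packaged for every arrangement and every
dimension; NOT a statement of any manuscript.]

Position: `y² + ℓ₁ ⋯ ℓ_n + R` over `k⟦x₀,…,x_m, y⟧`, `ℓ_t = Σ_l L_{t,l} x_l` linear forms, `n = 2r ≥ 2`, `R` of `(1,…,1,r)`-weighted order `> 2r`,
`k` algebraically closed of characteristic `2`.  Move: weights `(1,…,1,r)`, no coordinate change.  At the exceptional point `(c, γ)` the saturated
successor is `(γ + Y)² + B_c♮ + s·R″` with the TRANSLATED ARRANGEMENT `B_c = ∏_t (ℓ_t(c) + ℓ_t(x'))` (`transform_arrangement`).  Hence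
(`won_dp_arrangement_of_translateCross`): if for every `c ≠ 0` at which all LINEAR coefficients of `B_c` vanish some CROSS coefficient
`[x_i' x_j'] B_c` (`i ≠ j`) is non-zero, the position is won, given the singular germs in `m + 1` variables (`won_of_crossCoeff_ne_zero`); at
`c = 0` no successor is singular (`B_0(0) = 0`, `γ ≠ 0`).  `won_dp_arrangement_of_translateCross_four`: the N = 4 case, UNCONDITIONAL
(`surfaceGermsWon`).  The specimen is the arrangement `x₀, x₁, x₂, x₀+x₁+x₂` (cross coefficient `c_l²`).
-/

set_option linter.dupNamespace false -- mandated namespace of this single-conjunct summit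

namespace Summit.ResolutionOfSingularities.ResolutionOfSingularities.Theorems

open Literature.AlgebraicGeometry.Resolution
open Literature.AlgebraicGeometry.Resolution.CobordantGame

namespace ArrangementDoublePoint

open MvPowerSeries

variable {k : Type} [Field k] {m : ℕ}

/-- A linear form under the chart of weights `(1,…,1,r)`: `ℓ(chart) = s · (ℓ(c) + ℓ(x'))` (old slots). -/
theorem subst_cruxChart_linForm (r : ℕ) (pt : Fin (m + 1 + 1) → k) (L : Fin (m + 1) → k) :
    subst (cruxChart k (Fin.insertNth (α := fun _ => ℕ) (Fin.last (m + 1)) r (fun _ => 1)) pt)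
        (rename (Fin.succAboveEmb (Fin.last (m + 1))) (∑ l, C (L l) * X l : MvPowerSeries (Fin (m + 1)) k)) =
      X 0 * rename (Fin.succAboveEmb (Fin.last (m + 1 + 1)))
        (∑ l, (C (L l * pt (Fin.castSucc l)) + C (L l) * X l.succ) : MvPowerSeries (Fin (m + 1 + 1)) k) := by
  set Wt : Fin (m + 1 + 1) → ℕ := Fin.insertNth (α := fun _ => ℕ) (Fin.last (m + 1)) r (fun _ => 1) with hWt
  have hs := hasSubst_of_constantCoeff_zero (constantCoeff_cruxChart (k := k) Wt pt)
  have hslot : ∀ i : Fin (m + 1), cruxChart k Wt pt (Fin.castSucc i) =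
      X 0 * (C (pt (Fin.castSucc i)) + X (Fin.castSucc i.succ)) := by
    intro i
    rw [← Fin.succAbove_last, MultiplicityLift.cruxChart_succAbove hWt pt i]
    unfold cruxChart
    rw [if_pos one_pos, pow_one, map_mul, map_add, rename_X, rename_C, rename_X]
    simp only [Fin.coe_succAboveEmb, Fin.succAbove_last, Fin.castSucc_zero]
  rw [← coe_substAlgHom hs]
  simp only [map_sum, map_mul, map_add, coe_substAlgHom, subst_C, subst_X hs, rename_X, rename_C, Fin.coe_succAboveEmb,
    Fin.succAbove_last, hslot, Finset.mul_sum]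
  exact Finset.sum_congr rfl fun l _ => by ring

/-- THE TRANSFORM OF A DOUBLE POINT OVER AN ARRANGEMENT of `2r` linear forms under the chart of weights `(1,…,1,r)`:
`s^{2r} · ((γ + Y)² + (∏_t (ℓ_t(c) + ℓ_t(x')))♮)`. -/
theorem transform_arrangement (r : ℕ) (hr : 0 < r) {n : ℕ} (hn : n = 2 * r) (L : Fin n → Fin (m + 1) → k) (pt : Fin (m + 1 + 1) → k) :
    subst (cruxChart k (Fin.insertNth (α := fun _ => ℕ) (Fin.last (m + 1)) r (fun _ => 1)) pt)
        (X (Fin.last (m + 1)) ^ 2 + rename (Fin.succAboveEmb (Fin.last (m + 1)))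
          (∏ t, ∑ l, C (L t l) * X l : MvPowerSeries (Fin (m + 1)) k)) =
      X 0 ^ (2 * r) * ((C (pt (Fin.last (m + 1))) + X (Fin.last (m + 1 + 1))) ^ 2 +
        rename (Fin.succAboveEmb (Fin.last (m + 1 + 1)))
          (∏ t, ∑ l, (C (L t l * pt (Fin.castSucc l)) + C (L t l) * X l.succ) : MvPowerSeries (Fin (m + 1 + 1)) k)) := by
  subst hn
  set Wt : Fin (m + 1 + 1) → ℕ := Fin.insertNth (α := fun _ => ℕ) (Fin.last (m + 1)) r (fun _ => 1) with hWt
  have hs := hasSubst_of_constantCoeff_zero (constantCoeff_cruxChart (k := k) Wt pt)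
  have hlast : cruxChart k Wt pt (Fin.last (m + 1)) = X 0 ^ r * (C (pt (Fin.last (m + 1))) + X (Fin.last (m + 1 + 1))) := by
    rw [MultiplicityLift.cruxChart_last hWt pt, if_pos hr]
  rw [map_prod, ← coe_substAlgHom hs, map_add, map_pow, map_prod]
  simp only [coe_substAlgHom]
  rw [subst_X hs, hlast, Finset.prod_congr rfl fun t _ => subst_cruxChart_linForm r pt (L t), Finset.prod_mul_distrib,
    Finset.prod_const, Finset.card_univ, Fintype.card_fin, map_prod]
  ring

end ArrangementDoublePoint

open ArrangementDoublePoint MvPowerSeries in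
/-- **THE TRANSLATE-CROSS CRITERION** (`k` algebraically closed of characteristic `2`, every dimension, given the singular germs in `m + 1`
variables): the double point `y² + ℓ₁⋯ℓ_{2r} + R` over an arrangement of `2r ≥ 2` linear forms on the old variables (`R` of `(1,…,1,r)`-order
`> 2r`) is won by the move `(1,…,1,r)` as soon as, for every old-slot point `c ≠ 0` at which all linear coefficients of the translated
arrangement `B_c = ∏_t (ℓ_t(c) + ℓ_t(x'))` vanish, some cross coefficient `[x_i' x_j'] B_c` (`i ≠ j`) is non-zero. [OURS · L1 W4.3] -/
theorem won_dp_arrangement_of_translateCross (k : Type) [Field k] [CharP k 2] [IsAlgClosed k] {m : ℕ}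
    (hlow : ∀ g : MvPowerSeries (Fin (m + 1)) k, CobordantGame.IsSingular k g → CobordantGame.Won k (m + 1) g)
    (r : ℕ) (hr : 0 < r) {n : ℕ} (hn : n = 2 * r) (L : Fin n → Fin (m + 1) → k)
    (hcross : ∀ c : Fin (m + 1) → k, c ≠ 0 →
      (∀ l : Fin (m + 1), coeff (Finsupp.single l.succ 1)
        (∏ t, ∑ l', (C (L t l' * c l') + C (L t l') * X l'.succ) : MvPowerSeries (Fin (m + 1 + 1)) k) = 0) →
      ∃ i j : Fin (m + 1), i ≠ j ∧ coeff (Finsupp.single i.succ 1 + Finsupp.single j.succ 1)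
        (∏ t, ∑ l', (C (L t l' * c l') + C (L t l') * X l'.succ) : MvPowerSeries (Fin (m + 1 + 1)) k) ≠ 0)
    (R : MvPowerSeries (Fin (m + 1 + 1)) k)
    (hR : ((2 * r + 1 : ℕ) : ℕ∞) ≤ R.weightedOrder (Fin.insertNth (α := fun _ => ℕ) (Fin.last (m + 1)) r (fun _ => 1))) :
    CobordantGame.Won k (m + 1 + 1) (X (Fin.last (m + 1)) ^ 2 + rename (Fin.succAboveEmb (Fin.last (m + 1)))
      (∏ t, ∑ l, C (L t l) * X l : MvPowerSeries (Fin (m + 1)) k) + R) := by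
  classical
  set Wt : Fin (m + 1 + 1) → ℕ := Fin.insertNth (α := fun _ => ℕ) (Fin.last (m + 1)) r (fun _ => 1) with hWtdef
  set P : MvPowerSeries (Fin (m + 1 + 1)) k := X (Fin.last (m + 1)) ^ 2 + rename (Fin.succAboveEmb (Fin.last (m + 1)))
    (∏ t, ∑ l, C (L t l) * X l : MvPowerSeries (Fin (m + 1)) k) with hP
  have hWtlast : Wt (Fin.last (m + 1)) = r := by rw [hWtdef, Fin.insertNth_apply_same]
  have hWtcast : ∀ i, Wt (Fin.castSucc i) = 1 := fun i => by rw [hWtdef, ← Fin.succAbove_last, Fin.insertNth_apply_succAbove]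
  have hWtpos : ∀ l, 0 < Wt l := fun l => by
    rcases Fin.eq_castSucc_or_eq_last l with ⟨i, rfl⟩ | rfl
    · rw [hWtcast]; exact one_pos
    · rw [hWtlast]; exact hr
  have hmove : IsMove k (X : Fin (m + 1 + 1) → MvPowerSeries (Fin (m + 1 + 1)) k) Wt := by
    refine ⟨fun l => constantCoeff_X l, ?_, ⟨Fin.last (m + 1), by rw [hWtlast]; exact hr⟩⟩
    rw [← FormalCoordChange.linSubst_one, ConeDichotomy.linMat_linSubst, Matrix.det_one]
    exact isUnit_one
  refine Won.move X Wt hmove fun g hg => ?_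
  have hgS : CobordantGame.IsSingular k g := hg.isSingular
  obtain ⟨pt, a, ⟨l₀, hWl, hptl⟩, hfac, hndvd, hsing⟩ := hg
  have hself : subst (X : Fin (m + 1 + 1) → MvPowerSeries (Fin (m + 1 + 1)) k) (P + R) = P + R := by
    rw [subst_self]; rfl
  rw [hself] at hfac
  have hcc : cruxChart k Wt pt = CobordantChart.chart Wt pt := by
    have h := CobordantChart.cruxChart_eq_chart (k := k) Wt pt
    have hpt : (fun i => if 0 < Wt i then pt i else 0) = pt := funext fun i => if_pos (hWtpos i)
    rw [hpt] at h
    exact h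
  have hs := hasSubst_of_constantCoeff_zero (constantCoeff_cruxChart (k := k) Wt pt)
  obtain ⟨R'', hR''⟩ := exists_eq_X_pow_mul_of_le_weightedOrder Wt pt (fun i hi => absurd hi (hWtpos i).ne') R (2 * r + 1) hR
  set γ : k := pt (Fin.last (m + 1)) with hγ
  set c : Fin (m + 1) → k := fun i => pt (Fin.castSucc i) with hc
  set B : MvPowerSeries (Fin (m + 1 + 1)) k := ∏ t, ∑ l', (C (L t l' * c l') + C (L t l') * X l'.succ) with hB
  set Q : MvPowerSeries (Fin (m + 1 + 1 + 1)) k := (C γ + X (Fin.last (m + 1 + 1))) ^ 2 +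
    rename (Fin.succAboveEmb (Fin.last (m + 1 + 1))) B + X 0 * R'' with hQ
  have hTP : subst (cruxChart k Wt pt) P =
      X 0 ^ (2 * r) * ((C γ + X (Fin.last (m + 1 + 1))) ^ 2 + rename (Fin.succAboveEmb (Fin.last (m + 1 + 1))) B) :=
    transform_arrangement r hr hn L pt
  have hT : subst (cruxChart k Wt pt) (P + R) = X 0 ^ (2 * r) * Q := by
    rw [← coe_substAlgHom hs, map_add, coe_substAlgHom, hTP, hcc, hR'', hQ]
    ring
  -- `s ∤ Q`
  have hndvd₀ : ¬ X 0 ∣ Q := by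
    intro h
    have h1 := (X_dvd_iff.mp h) (Finsupp.single (Fin.last (m + 1 + 1)) 2) (by rw [Finsupp.single_apply, if_neg Fin.last_pos.ne'])
    rw [hQ, map_add, map_add, MultiplicityLift.coeff_single_rename_eq_zero B two_ne_zero, add_zero,
      coeff_X_zero_mul_eq_zero (by rw [Finsupp.single_apply, if_neg Fin.last_pos.ne']), add_zero,
      ← one_mul ((C γ + X (Fin.last (m + 1 + 1))) ^ 2), ← map_one C, MultiplicityLift.coeff_single_C_mul_add_pow] at h1
    simp at h1
  rw [hT] at hfac
  obtain ⟨-, hgg⟩ := X_pow_mul_eq_X_pow_mul 0 hfac hndvd₀ hndvd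
  subst hgg
  have he0 : ∀ u : Fin (m + 1), (Fin.succAboveEmb (Fin.last (m + 1 + 1))) u.succ ≠ 0 := fun u => by
    rw [Fin.coe_succAboveEmb, Fin.succAbove_last]
    exact Fin.castSucc_ne_zero_iff.mpr (Fin.succ_ne_zero u)
  have hel : ∀ u : Fin (m + 1), (Fin.succAboveEmb (Fin.last (m + 1 + 1))) u.succ ≠ Fin.last (m + 1 + 1) := fun u => by
    rw [Fin.coe_succAboveEmb]; exact Fin.succAbove_ne _ _
  by_cases hc0 : c = 0
  · -- `c = 0`: `B(0) = 0` (a product of `n ≥ 1` linear forms without constant terms), `γ ≠ 0`, `Q(0) = γ²`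
    exfalso
    have hγ0 : γ ≠ 0 := by
      rcases Fin.eq_castSucc_or_eq_last l₀ with ⟨i, rfl⟩ | h
      · exact absurd (congrFun hc0 i) hptl
      · rw [hγ, ← h]; exact hptl
    have hB0 : constantCoeff B = 0 := by
      have hn0 : 0 < n := by omega
      rw [hB, map_prod]
      refine Finset.prod_eq_zero (Finset.mem_univ (⟨0, hn0⟩ : Fin n)) ?_
      rw [map_sum]
      refine Finset.sum_eq_zero fun l' _ => ?_
      have hcl : c l' = 0 := congrFun hc0 l'
      simp only [map_add, map_mul, constantCoeff_C, constantCoeff_X, mul_zero, add_zero, hcl]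
    have h00 := hsing.1
    have hX0R : constantCoeff (X 0 * R'' : MvPowerSeries (Fin (m + 1 + 1 + 1)) k) = 0 := by rw [map_mul, constantCoeff_X, zero_mul]
    rw [hQ, map_add, map_add, TerminalDoublePointDim.constantCoeff_C_add_X_sq, constantCoeff_rename, hB0, hX0R, add_zero, add_zero] at h00
    exact hγ0 (pow_eq_zero_iff two_ne_zero |>.mp h00)
  · -- `c ≠ 0`: the linear coefficients of `B` vanish (singularity), so some cross coefficient does not
    have hlin : ∀ l : Fin (m + 1), coeff (Finsupp.single l.succ 1) B = 0 := by
      intro l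
      have h1 := hsing.2 ((Fin.succAboveEmb (Fin.last (m + 1 + 1))) l.succ)
      rw [hQ, map_add, map_add, TerminalDoublePointDim.coeff_single_C_add_X_sq_of_ne γ _ (hel l), zero_add,
        coeff_X_zero_mul_eq_zero (by rw [Finsupp.single_apply, if_neg (he0 l)]), add_zero,
        ← Finsupp.embDomain_single, coeff_embDomain_rename] at h1
      exact h1
    obtain ⟨i, j, hij, hne⟩ := hcross c hc0 hlin
    refine won_of_crossCoeff_ne_zero (n := m) hlow _ hgS
      (fun h => hij (Fin.succ_injective _ ((Fin.succAboveEmb (Fin.last (m + 1 + 1))).injective h))) ?_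
    rw [hQ, map_add, map_add, coeff_pair_C_add_X_sq_of_ne γ _ _ (hel i) (hel j), zero_add,
      coeff_X_zero_mul_eq_zero (by rw [Finsupp.add_apply, Finsupp.single_apply, Finsupp.single_apply, if_neg (he0 i), if_neg (he0 j), add_zero]),
      add_zero, ← Finsupp.embDomain_single, ← Finsupp.embDomain_single, ← Finsupp.embDomain_add, coeff_embDomain_rename]
    exact hne

open ArrangementDoublePoint MvPowerSeries in
/-- **N = 4, UNCONDITIONAL**: the translate-cross criterion for double points `y² + ℓ₁⋯ℓ_{2r} + R` over arrangements of planes in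
`k⟦x₀,x₁,x₂,y⟧` (`k` algebraically closed of characteristic `2`; the surface germs are won by `surfaceGermsWon`). [OURS · L1 W4.3 · W4|₄ ∩ {d=2}] -/
theorem won_dp_arrangement_of_translateCross_four (k : Type) [Field k] [CharP k 2] [IsAlgClosed k]
    (r : ℕ) (hr : 0 < r) {n : ℕ} (hn : n = 2 * r) (L : Fin n → Fin 3 → k)
    (hcross : ∀ c : Fin 3 → k, c ≠ 0 →
      (∀ l : Fin 3, coeff (Finsupp.single l.succ 1)
        (∏ t, ∑ l', (C (L t l' * c l') + C (L t l') * X l'.succ) : MvPowerSeries (Fin 4) k) = 0) →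
      ∃ i j : Fin 3, i ≠ j ∧ coeff (Finsupp.single i.succ 1 + Finsupp.single j.succ 1)
        (∏ t, ∑ l', (C (L t l' * c l') + C (L t l') * X l'.succ) : MvPowerSeries (Fin 4) k) ≠ 0)
    (R : MvPowerSeries (Fin 4) k)
    (hR : ((2 * r + 1 : ℕ) : ℕ∞) ≤ R.weightedOrder (Fin.insertNth (α := fun _ => ℕ) (Fin.last 3) r (fun _ => 1))) :
    CobordantGame.Won k 4 (X (Fin.last 3) ^ 2 + rename (Fin.succAboveEmb (Fin.last 3))
      (∏ t, ∑ l, C (L t l) * X l : MvPowerSeries (Fin 3) k) + R) :=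
  won_dp_arrangement_of_translateCross k (m := 2) (surfaceGermsWon 2 Nat.prime_two k) r hr hn L hcross R hR

end Summit.ResolutionOfSingularities.ResolutionOfSingularities.Theorems
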